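import Summits.KontsevichZagierPeriods.KontsevichZagierPeriods.Theorems.BetaCancellation.Negative.Torsion
import Summits.KontsevichZagierPeriods.KontsevichZagierPeriods.Theorems.BetaCancellation.Negative.EulerReflectionStub
import Summits.KontsevichZagierPeriods.KontsevichZagierPeriods.Theorems.TerasomaMultiplicationGammaHodgeFromRelatorsChains
import Summits.KontsevichZagierPeriods.KontsevichZagierPeriods.Theorems.TerasomaMultiplicationTriplicationFromMultiplicationDirichlet
import Summits.KontsevichZagierPeriods.KontsevichZagierPeriods.Theorems.TerasomaMultiplicationBetaCancellationStubDirichletPolar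
import Summits.KontsevichZagierPeriods.KontsevichZagierPeriods.Theorems.TerasomaMultiplicationBetaCancellationStubDirichletLinear
import Summits.KontsevichZagierPeriods.KontsevichZagierPeriods.Theorems.TerasomaMultiplicationBetaCancellationStubIntegrateOut
import Summits.KontsevichZagierPeriods.KontsevichZagierPeriods.Theorems.TerasomaMultiplicationBetaCancellationEulerFinal
import Literature.NumberTheory.Transcendental.KZProductIdeal
import Literature.NumberTheory.Transcendental.KZLogCalculusProofs

/-!
# `BetaCancellation` (stmt-KontsevichZagierPeriods-13633) IS `KZ.PiCancellation` (stmt-0540)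

Line `dirichlet-companion-to-pi` assembled (lead glue; helper file `--supports` the crux; `betaRep` is
`GammaHodgeSectorKO.betaRep`, scalar cancellation is `Negative/Torsion.lean`'s). From the
four landed explicit stubs (`stub_betaTranslation`, `stub_dirichletPolar`, `stub_dirichletLinear`,
`stub_integrateOut`) and Euler reflection inside the calculus (`stub_eulerReflection :
EulerReflectionRational`, item stmt-3383, `TerasomaMultiplicationBetaCancellationEulerFinal.lean`):
`companion_collapse` `[β(a+b,1−b)] × [β(a,b)] ∼ [(0,1), a⁻¹ t^{b-1}(1-t)^{-b}]`,
`reflection_collapse` `… ∼ (a sin πb)⁻¹ · [π]`, hence `KZ.PiCancellation → KernelCancellation (β(a,b))`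
for `0 < b < 1` (multiply the pinned hypothesis by the companion, collapse to `[π]`, cancel `[π]`);
translation `b ↦ b+1` and the symmetry `(a,b) ↔ (b,a)` reach every positive rational `(a,b)`:
`betaCancellation_of_piCancellation : KZ.PiCancellation → BetaCancellation`, and with the converse
`BetaCancellationNegative.piCancellation_of_betaCancellation` (`Negative/PiLink.lean`,
`[β(1/2,1/2)] ∼ [π]`) the unconditional `betaCancellation_iff_piCancellation :
BetaCancellation ↔ KZ.PiCancellation`. The crux carries exactly the content of the open
`π`-cancellation item stmt-0540; its closing file is `betaCancellation_of_piCancellation h0540`.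
-/

noncomputable section

-- `Summit.KontsevichZagierPeriods.KontsevichZagierPeriods.…` is the tree's mandated layout (single-conjunct summit).
set_option linter.dupNamespace false

namespace Summit.KontsevichZagierPeriods.KontsevichZagierPeriods.BetaCancellationLine

open MeasureTheory Set
open Literature.NumberTheory.Transcendental
open Literature.NumberTheory.Transcendental.KZ
open Literature.ModelTheory.ExponentialFields (IsSemialgebraic isSemialgebraic_univ)
open MvPolynomial (aeval X C)
open Summit.KontsevichZagierPeriods.KontsevichZagierPeriods.Theses.TerasomaMultiplication
  (BetaCancellation)
open Summit.KontsevichZagierPeriods.KontsevichZagierPeriods.Theses.CompiledSubstitutions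
  (EulerReflectionRational)
open Summit.KontsevichZagierPeriods.KontsevichZagierPeriods.BetaCancellationNegative
open Literature.NumberTheory.Transcendental.KZreg (unitIoo isSemialgebraic_unitIoo volume_unitIoo)
open Summit.KontsevichZagierPeriods.GammaHodgeSectorKO (betaRep betaRep_domain betaRep_integrand)
open Summit.KontsevichZagierPeriods.TerasomaMultiplication.TriplicationGlue (castAdd_one_zero natAdd_one_zero)
open Summit.KontsevichZagierPeriods.TerasomaMultiplication.GammaHodgeFromRelators (isAlgebraic_ratCast)

/-! ## Pinned representations are products -/

/-- `[β(a,b)] × r` is pinned over `r` with the Beta kernel. [folklore] -/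
theorem isPinned_betaRep_prod {n : ℕ} (a b : ℚ) (ha : 0 < a) (hb : 0 < b) (r : IntegralRep n) :
    IsPinned (betaKernel a b) r ((betaRep a b ha hb).prod r) :=
  isPinned_prod (betaRep a b ha hb) rfl (fun _ _ => rfl) r

/-- Two representations pinned with the same kernel over the same base are equivalent (same
domain, integrands agree on it). [folklore] -/
theorem equivalent_of_isPinned_of_isPinned {n : ℕ} {k : ℝ → ℝ} {r : IntegralRep n}
    {q q₂ : IntegralRep (1 + n)} (hq : IsPinned k r q) (hq₂ : IsPinned k r q₂) :
    Equivalent q q₂ := by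
  refine of_sub_of_mem_relations_of_eqOn (hq₂.1.trans hq.1.symm) fun z hz => ?_
  rw [hq.2 hz, hq₂.2 (hq₂.1.symm ▸ hq.1 ▸ hz)]

/-- A representation pinned with the Beta kernel over `r` is equivalent to `[β(a,b)] × r`.
[folklore] -/
theorem equivalent_betaRep_prod_of_isPinned {n : ℕ} {a b : ℚ} (ha : 0 < a) (hb : 0 < b)
    {r : IntegralRep n} {q : IntegralRep (1 + n)} (hq : IsPinned (betaKernel a b) r q) :
    Equivalent q ((betaRep a b ha hb).prod r) :=
  equivalent_of_isPinned_of_isPinned hq (isPinned_betaRep_prod a b ha hb r)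

/-! ## Symmetry `(a,b) ↔ (b,a)`: reflecting the kernel coordinate -/

/-- `[β(a,b)] × r ∼ [β(b,a)] × r`: one rule-2 move `z₀ ↦ 1 − z₀` (`KZ.boxReflection`). [folklore] -/
theorem equivalent_betaRep_prod_swap {n : ℕ} (a b : ℚ) (ha : 0 < a) (hb : 0 < b)
    (r : IntegralRep n) :
    Equivalent ((betaRep a b ha hb).prod r) ((betaRep b a hb ha).prod r) := by
  refine of_sub_of_mem_relations_of_boxReflection (Fin.castAdd n (0 : Fin 1)) ?_ ?_
  · ext z
    simp only [IntegralRep.prod_domain, IntegralRep.mem_prodDomain, betaRep_domain, mem_unitIoo,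
      mem_Ioo, mem_preimage, boxReflection_apply_self]
    have htail : (fun j => boxReflection (Fin.castAdd n (0 : Fin 1)) z (Fin.natAdd 1 j)) =
        fun j => z (Fin.natAdd 1 j) := by
      funext j
      rw [boxReflection_apply_of_ne]
      intro h
      have := congrArg Fin.val h
      simp at this
    rw [htail]
    constructor
    · rintro ⟨⟨h1, h2⟩, h3⟩; exact ⟨⟨by linarith, by linarith⟩, h3⟩
    · rintro ⟨⟨h1, h2⟩, h3⟩; exact ⟨⟨by linarith, by linarith⟩, h3⟩
  · intro z _
    rw [IntegralRep.prod_integrand_eq, IntegralRep.prod_integrand_eq]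
    simp only [IntegralRep.prodFun, betaRep_integrand, boxReflection_apply_self]
    have htail : (fun j => boxReflection (Fin.castAdd n (0 : Fin 1)) z (Fin.natAdd 1 j)) =
        fun j => z (Fin.natAdd 1 j) := by
      funext j
      rw [boxReflection_apply_of_ne]
      intro h
      have := congrArg Fin.val h
      simp at this
    rw [htail, betaKernel_one_sub]

/-- **Symmetry of Beta cancellation**: `KernelCancellation (β(b,a)) → KernelCancellation (β(a,b))`.
[folklore] -/
theorem kernelCancellation_betaKernel_symm {a b : ℚ} (ha : 0 < a) (hb : 0 < b)
    (h : KernelCancellation (betaKernel b a)) : KernelCancellation (betaKernel a b) := by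
  intro n m r r' q q' hq hq' hqq'
  have h1 : Equivalent ((betaRep b a hb ha).prod r) ((betaRep b a hb ha).prod r') :=
    (((equivalent_betaRep_prod_swap a b ha hb r).symm.trans
      (equivalent_betaRep_prod_of_isPinned ha hb hq).symm).trans hqq').trans
      ((equivalent_betaRep_prod_of_isPinned ha hb hq').trans (equivalent_betaRep_prod_swap a b ha hb r'))
  exact h r r' _ _ (isPinned_betaRep_prod b a hb ha r) (isPinned_betaRep_prod b a hb ha r') h1

/-! ## Scaling bookkeeping -/

/-- Scaling the first factor of a product scales the product. [folklore] -/
theorem constMul_prod_eq {l n : ℕ} (t : IntegralRep l) (r : IntegralRep n) {c : ℝ}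
    (hc : IsAlgebraic ℚ c) : (t.constMul c hc).prod r = (t.prod r).constMul c hc := by
  refine IntegralRep.ext' rfl ?_
  rw [IntegralRep.prod_integrand_eq, IntegralRep.integrand_constMul, IntegralRep.prod_integrand_eq]
  funext z
  simp only [IntegralRep.prodFun, IntegralRep.integrand_constMul, mul_assoc]

/-! ## Associativity of the product modulo relations -/

/-- `t × (s × r) ∼ (t × s) × r` (a coordinate relabelling, `KZ.of_sub_of_reindex_mem_relations`).
[folklore] -/
theorem equivalent_prod_assoc {l m n : ℕ} (t : IntegralRep l) (s : IntegralRep m) (r : IntegralRep n) :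
    Equivalent (t.prod (s.prod r)) ((t.prod s).prod r) := by
  let e : Fin (l + m + n) ≃ Fin (l + (m + n)) := finCongr (Nat.add_assoc l m n)
  have key : t.prod (s.prod r) = ((t.prod s).prod r).reindex e := by
    have h1 : ∀ (w : Fin (l + (m + n)) → ℝ) (i : Fin l),
        w (e (Fin.castAdd n (Fin.castAdd m i))) = w (Fin.castAdd (m + n) i) := by
      intro w i; congr 1
    have h2 : ∀ (w : Fin (l + (m + n)) → ℝ) (j : Fin m),
        w (e (Fin.castAdd n (Fin.natAdd l j))) = w (Fin.natAdd l (Fin.castAdd n j)) := by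
      intro w j; congr 1
    have h3 : ∀ (w : Fin (l + (m + n)) → ℝ) (j : Fin n),
        w (e (Fin.natAdd (l + m) j)) = w (Fin.natAdd l (Fin.natAdd m j)) := by
      intro w j; congr 1; ext; simp [e, Nat.add_assoc]
    refine IntegralRep.ext' ?_ ?_
    · ext w
      simp only [IntegralRep.prod_domain, IntegralRep.mem_prodDomain, IntegralRep.reindex_domain,
        mem_setOf_eq, h1, h2, h3]
      exact and_assoc.symm
    · rw [IntegralRep.reindex_integrand, IntegralRep.prod_integrand_eq, IntegralRep.prod_integrand_eq]
      funext w
      simp only [IntegralRep.prodFun, IntegralRep.prod_integrand_eq, h1, h2, h3, mul_assoc]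
  rw [key]
  have h := of_sub_of_reindex_mem_relations ((t.prod s).prod r) e
  have h' := relations.neg_mem h
  simpa [Equivalent] using h'

/-! ## Cast bookkeeping -/

/-- `((a + b : ℚ) : ℝ) - 1 = a + b - 1`. [folklore] -/
theorem cast_add_sub_one (a b : ℚ) : (((a + b : ℚ) : ℝ) - 1) = (a:ℝ) + b - 1 := by push_cast; ring

/-- `((1 - b : ℚ) : ℝ) - 1 = -b`. [folklore] -/
theorem cast_one_sub_sub_one (b : ℚ) : (((1 - b : ℚ) : ℝ) - 1) = -(b:ℝ) := by push_cast; ring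

/-- `((b + 1 : ℚ) : ℝ) - 1 = b`. [folklore] -/
theorem cast_add_one_sub_one (b : ℚ) : (((b + 1 : ℚ) : ℝ) - 1) = (b:ℝ) := by push_cast; ring

/-- `((1 : ℚ) : ℝ) - 1 = 0`. [folklore] -/
theorem cast_one_sub_one : (((1 : ℚ) : ℝ) - 1) = (0:ℝ) := by push_cast; ring

/-- The domain of a product of two `(0,1)`-representations is the open box, in the stubs' spelling.
[folklore] -/
theorem prod_domain_eq_box (κ β : IntegralRep 1) (hκ : κ.domain = unitIoo) (hβ : β.domain = unitIoo) :
    (κ.prod β).domain = {z : Fin 2 → ℝ | z 0 ∈ Set.Ioo (0:ℝ) 1 ∧ z 1 ∈ Set.Ioo (0:ℝ) 1} := by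
  ext z
  simp only [IntegralRep.prod_domain, IntegralRep.mem_prodDomain, hκ, hβ, mem_unitIoo, mem_setOf_eq,
    castAdd_one_zero, natAdd_one_zero]

/-- The integrand of a product of two Beta representations, coordinatewise. [folklore] -/
theorem betaRep_prod_betaRep_integrand (a b a' b' : ℚ) (ha : 0 < a) (hb : 0 < b) (ha' : 0 < a')
    (hb' : 0 < b') (z : Fin (1 + 1) → ℝ) :
    ((betaRep a b ha hb).prod (betaRep a' b' ha' hb')).integrand z =
      betaKernel a b (z 0) * betaKernel a' b' (z 1) := by
  rw [IntegralRep.prod_integrand_eq]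
  simp only [IntegralRep.prodFun, betaRep_integrand, castAdd_one_zero, natAdd_one_zero]

/-! ## The companion collapse `[β(a+b,1−b)] × [β(a,b)] ∼ [(0,1), a⁻¹ t^{b-1}(1-t)^{-b}]` -/

/-- **Companion collapse** (from `stub_dirichletPolar`, `stub_dirichletLinear`, `stub_integrateOut`):
for `0 < a` and `0 < b < 1`, `[β(a+b,1−b)] × [β(a,b)] ∼ [(0,1), a⁻¹ · t^{b-1}(1-t)^{-b}]`
(value identity `B(a+b,1−b)·B(a,b) = B(b,1−b)/a`). [folklore] -/
theorem companion_collapse {a b : ℚ} (ha : 0 < a) (hb : 0 < b) (hb1 : b < 1) (hab : 0 < a + b)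
    (h1b : 0 < 1 - b) :
    Equivalent ((betaRep (a + b) (1 - b) hab h1b).prod (betaRep a b ha hb))
      ((betaRep b (1 - b) hb h1b).constMul (((a:ℚ):ℝ)⁻¹) (isAlgebraic_ratCast a).inv) := by
  set P := (betaRep (a + b) (1 - b) hab h1b).prod (betaRep a b ha hb) with hP
  have hPd : P.domain = {z : Fin 2 → ℝ | z 0 ∈ Set.Ioo (0:ℝ) 1 ∧ z 1 ∈ Set.Ioo (0:ℝ) 1} :=
    prod_domain_eq_box _ _ rfl rfl
  have hPi : Set.EqOn P.integrand (fun z => (z 0) ^ ((a:ℝ) + b - 1) * (1 - z 0) ^ (-(b:ℝ)) *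
      ((z 1) ^ ((a:ℝ) - 1) * (1 - z 1) ^ ((b:ℝ) - 1))) P.domain := by
    intro z _
    rw [hP, betaRep_prod_betaRep_integrand]
    simp only [betaKernel, cast_add_sub_one, cast_one_sub_sub_one]
  obtain ⟨S, hSd, hSi, hPS⟩ := stub_dirichletPolar a b ha hb hb1 P hPd hPi
  set B := (betaRep b (1 - b) hb h1b).prod (betaRep a 1 ha one_pos) with hB
  have hBd : B.domain = {z : Fin 2 → ℝ | z 0 ∈ Set.Ioo (0:ℝ) 1 ∧ z 1 ∈ Set.Ioo (0:ℝ) 1} :=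
    prod_domain_eq_box _ _ rfl rfl
  have hBi : Set.EqOn B.integrand (fun z => (z 0) ^ ((b:ℝ) - 1) * (1 - z 0) ^ (-(b:ℝ)) *
      (z 1) ^ ((a:ℝ) - 1)) B.domain := by
    intro z _
    rw [hB, betaRep_prod_betaRep_integrand]
    simp only [betaKernel, cast_one_sub_sub_one, cast_one_sub_one, Real.rpow_zero, mul_one]
  have hSB := stub_dirichletLinear a b ha hb hb1 S B hSd hSi hBd hBi
  set R := (betaRep b (1 - b) hb h1b).constMul (((a:ℚ):ℝ)⁻¹) (isAlgebraic_ratCast a).inv with hR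
  have hRd : R.domain = {x : Fin 1 → ℝ | x 0 ∈ Set.Ioo (0:ℝ) 1} := rfl
  have hRi : Set.EqOn R.integrand
      (fun x => ((a:ℚ):ℝ)⁻¹ * ((x 0) ^ ((b:ℝ) - 1) * (1 - x 0) ^ (-(b:ℝ)))) R.domain := by
    intro x _
    simp only [hR, IntegralRep.integrand_constMul, betaRep_integrand, betaKernel, cast_one_sub_sub_one]
  have hBR := stub_integrateOut a b ha hb hb1 B R hBd hBi hRd hRi
  exact hPS.trans (hSB.trans hBR)

/-! ## Euler reflection: `[(0,1), a⁻¹ t^{b-1}(1-t)^{-b}] ∼ (a sin πb)⁻¹ · [π]` -/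

/-- `0 < sin(πb)` for `0 < b < 1`. [folklore] -/
theorem sin_pi_mul_pos {b : ℚ} (hb : 0 < b) (hb1 : b < 1) : 0 < Real.sin (Real.pi * b) := by
  have hb' : (0:ℝ) < b := by exact_mod_cast hb
  have hb1' : (b:ℝ) < 1 := by exact_mod_cast hb1
  refine Real.sin_pos_of_pos_of_lt_pi (by positivity) ?_
  nlinarith [Real.pi_pos]

/-- **Reflection step** (from `stub_eulerReflection`): for `0 < a`, `0 < b < 1`,
`[(0,1), a⁻¹ t^{b-1}(1-t)^{-b}] ∼ (a·sin πb)⁻¹ · [π]`. [folklore] -/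
theorem reflection_collapse {a b : ℚ} (ha : 0 < a) (hb : 0 < b) (hb1 : b < 1) (h1b : 0 < 1 - b)
    (hk : IsAlgebraic ℚ ((a:ℝ) * Real.sin (Real.pi * b)))
    (hk0 : (a:ℝ) * Real.sin (Real.pi * b) ≠ 0) :
    Equivalent ((betaRep b (1 - b) hb h1b).constMul (((a:ℚ):ℝ)⁻¹) (isAlgebraic_ratCast a).inv)
      (piRep.constMul (((a:ℝ) * Real.sin (Real.pi * b))⁻¹) hk.inv) := by
  set R := (betaRep b (1 - b) hb h1b).constMul (((a:ℚ):ℝ)⁻¹) (isAlgebraic_ratCast a).inv with hR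
  set E := R.constMul ((a:ℝ) * Real.sin (Real.pi * b)) hk with hE
  have ha0 : ((a:ℚ):ℝ) ≠ 0 := by positivity
  have hEd : E.domain = {x : Fin 1 → ℝ | x 0 ∈ Set.Ioo (0:ℝ) 1} := rfl
  have hEi : Set.EqOn E.integrand (fun x => Real.sin (Real.pi * b) * (x 0) ^ ((b:ℝ) - 1) *
      (1 - x 0) ^ (-(b:ℝ))) E.domain := by
    intro x _
    simp only [hE, hR, IntegralRep.integrand_constMul, betaRep_integrand, betaKernel,
      cast_one_sub_sub_one]
    field_simp
  have hEpi : Equivalent E piRep :=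
    stub_eulerReflection b hb hb1 E piRep hEd hEi rfl (fun _ _ => rfl)
  have h2 := hEpi.constMul ((a:ℝ) * Real.sin (Real.pi * b))⁻¹ hk.inv
  rwa [hE, constMul_inv_constMul R hk hk0] at h2

/-! ## The non-integer regime `0 < b < 1`: companion, reflection, `π`-cancellation -/

/-- **`KernelCancellation (β(a,b))` for `0 < a`, `0 < b < 1`** (companion collapse + Euler
reflection + `KZ.PiCancellation` as a hypothesis). [folklore] -/
theorem kernelCancellation_betaKernel_of_lt_one (hπ : KZ.PiCancellation) {a b : ℚ} (ha : 0 < a)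
    (hb : 0 < b) (hb1 : b < 1) : KernelCancellation (betaKernel a b) := by
  intro n m r r' q q' hq hq' hqq'
  have hab : 0 < a + b := by linarith
  have h1b : 0 < 1 - b := by linarith
  have hk : IsAlgebraic ℚ ((a:ℝ) * Real.sin (Real.pi * b)) :=
    (isAlgebraic_ratCast a).mul (isAlgebraic_sin_pi_mul_rat hb)
  have hk0 : (a:ℝ) * Real.sin (Real.pi * b) ≠ 0 :=
    mul_ne_zero (by positivity) (sin_pi_mul_pos hb hb1).ne'
  set κ := betaRep (a + b) (1 - b) hab h1b with hκ
  set β := betaRep a b ha hb with hβ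
  set Pc := piRep.constMul (((a:ℝ) * Real.sin (Real.pi * b))⁻¹) hk.inv with hPc
  have hcoll : Equivalent (κ.prod β) Pc :=
    (companion_collapse ha hb hb1 hab h1b).trans (reflection_collapse ha hb hb1 h1b hk hk0)
  have chain : ∀ {k : ℕ} (ρ : IntegralRep k) (p : IntegralRep (1 + k)),
      IsPinned (betaKernel a b) ρ p → Equivalent (κ.prod p) (Pc.prod ρ) := by
    intro k ρ p hp
    exact ((Equivalent.prod (Equivalent.refl κ) (equivalent_betaRep_prod_of_isPinned ha hb hp)).trans
      (equivalent_prod_assoc κ β ρ)).trans (Equivalent.prod hcoll (Equivalent.refl ρ))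
  have h1 : Equivalent (Pc.prod r) (Pc.prod r') :=
    ((chain r q hq).symm.trans (Equivalent.prod (Equivalent.refl κ) hqq')).trans (chain r' q' hq')
  have h2 : Equivalent (piRep.prod r) (piRep.prod r') := by
    refine equivalent_of_equivalent_constMul hk.inv (inv_ne_zero hk0) ?_
    rw [← constMul_prod_eq, ← constMul_prod_eq]
    exact h1
  have h3 : of piRep * (of r - of r') ∈ relations := by
    rw [mul_sub, of_mul_of, of_mul_of]
    exact h2
  exact hπ _ h3

/-! ## Translation `b ↦ b + 1` -/

/-- **`KernelCancellation (β(a,b)) → KernelCancellation (β(a,b+1))`** (from `stub_betaTranslation`: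
`(a+b)·[β(a,b+1)] ∼ b·[β(a,b)]`, and scalars cancel). [folklore] -/
theorem kernelCancellation_betaKernel_succ {a b : ℚ} (ha : 0 < a) (hb : 0 < b)
    (h : KernelCancellation (betaKernel a b)) : KernelCancellation (betaKernel a (b + 1)) := by
  intro n m r r' q q' hq hq' hqq'
  have hb1 : 0 < b + 1 := by linarith
  have hab : IsAlgebraic ℚ ((a:ℝ) + b) := by
    have := isAlgebraic_ratCast (a + b)
    push_cast at this
    exact this
  have hbalg : IsAlgebraic ℚ ((b:ℚ):ℝ) := isAlgebraic_ratCast b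
  have hb0 : ((b:ℚ):ℝ) ≠ 0 := by positivity
  set ρ := (betaRep a (b + 1) ha hb1).constMul ((a:ℝ) + b) hab with hρ
  set ρ' := (betaRep a b ha hb).constMul ((b:ℚ):ℝ) hbalg with hρ'
  have hρρ' : Equivalent ρ ρ' := by
    refine stub_betaTranslation a b ha hb ρ ρ' rfl (fun x _ => ?_) rfl (fun x _ => ?_)
    · simp only [hρ, IntegralRep.integrand_constMul, betaRep_integrand, betaKernel, cast_add_one_sub_one]
    · simp only [hρ', IntegralRep.integrand_constMul, betaRep_integrand, betaKernel]
  have chain : ∀ {k : ℕ} (σ : IntegralRep k) (p : IntegralRep (1 + k)),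
      IsPinned (betaKernel a (b + 1)) σ p →
      Equivalent (p.constMul ((a:ℝ) + b) hab) (((betaRep a b ha hb).prod σ).constMul ((b:ℚ):ℝ) hbalg) := by
    intro k σ p hp
    have e1 := (equivalent_betaRep_prod_of_isPinned ha hb1 hp).constMul ((a:ℝ) + b) hab
    rw [← constMul_prod_eq] at e1
    have e2 : Equivalent (ρ.prod σ) (ρ'.prod σ) := Equivalent.prod hρρ' (Equivalent.refl σ)
    rw [hρ', constMul_prod_eq (betaRep a b ha hb) σ hbalg] at e2
    exact e1.trans e2
  have h1 := ((chain r q hq).symm.trans (hqq'.constMul _ hab)).trans (chain r' q' hq')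
  have h2 := equivalent_of_equivalent_constMul hbalg hb0 h1
  exact h r r' _ _ (isPinned_betaRep_prod a b ha hb r) (isPinned_betaRep_prod a b ha hb r') h2

/-- Iterated translation. [folklore] -/
theorem kernelCancellation_betaKernel_add_nat {a b : ℚ} (ha : 0 < a) (hb : 0 < b)
    (h : KernelCancellation (betaKernel a b)) (k : ℕ) : KernelCancellation (betaKernel a (b + k)) := by
  induction k with
  | zero => simpa using h
  | succ k ih =>
    have := kernelCancellation_betaKernel_succ ha (by positivity) ih
    push_cast
    rwa [← add_assoc]

/-- Every positive rational is `b₀ + k` with `b₀ ∈ (0,1]` and `k ∈ ℕ`. [folklore] -/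
theorem exists_frac_add_nat {b : ℚ} (hb : 0 < b) :
    ∃ (b₀ : ℚ) (k : ℕ), 0 < b₀ ∧ b₀ ≤ 1 ∧ b = b₀ + k := by
  have h1 : (1:ℤ) ≤ ⌈b⌉ := Int.one_le_ceil_iff.2 hb
  have h2 : (((⌈b⌉ - 1).toNat : ℕ) : ℚ) = ((⌈b⌉ : ℤ) : ℚ) - 1 := by
    have := Int.toNat_of_nonneg (sub_nonneg.2 h1)
    exact_mod_cast this
  refine ⟨b - ((⌈b⌉ - 1).toNat : ℕ), (⌈b⌉ - 1).toNat, ?_, ?_, by ring⟩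
  · rw [h2]
    have := Int.ceil_lt_add_one b
    linarith
  · rw [h2]
    have := Int.le_ceil b
    linarith

/-- `KernelCancellation (β(1,a))` for every rational `a > 0`. [folklore] -/
theorem kernelCancellation_betaKernel_one_left (hπ : KZ.PiCancellation) {a : ℚ} (ha : 0 < a) :
    KernelCancellation (betaKernel 1 a) := by
  obtain ⟨a₀, k, h0, h1, rfl⟩ := exists_frac_add_nat ha
  refine kernelCancellation_betaKernel_add_nat one_pos h0 ?_ k
  rcases h1.lt_or_eq with h1 | rfl
  · exact kernelCancellation_betaKernel_of_lt_one hπ one_pos h0 h1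
  · exact kernelCancellation_betaKernel_one_one

/-- `KernelCancellation (β(a,b₀))` for `0 < a` and `b₀ ∈ (0,1]`. [folklore] -/
theorem kernelCancellation_betaKernel_base (hπ : KZ.PiCancellation) {a b₀ : ℚ} (ha : 0 < a) (h0 : 0 < b₀)
    (h1 : b₀ ≤ 1) : KernelCancellation (betaKernel a b₀) := by
  rcases h1.lt_or_eq with h1 | rfl
  · exact kernelCancellation_betaKernel_of_lt_one hπ ha h0 h1
  · exact kernelCancellation_betaKernel_symm ha one_pos (kernelCancellation_betaKernel_one_left hπ ha)

/-- **`KernelCancellation (β(a,b))` for all positive rationals `a, b`.** [folklore] -/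
theorem kernelCancellation_betaKernel_of_pos (hπ : KZ.PiCancellation) {a b : ℚ} (ha : 0 < a) (hb : 0 < b) :
    KernelCancellation (betaKernel a b) := by
  obtain ⟨b₀, k, h0, h1, rfl⟩ := exists_frac_add_nat hb
  exact kernelCancellation_betaKernel_add_nat ha h0 (kernelCancellation_betaKernel_base hπ ha h0 h1) k

/-! ## The crux is `π`-cancellation -/

/-- **`KZ.PiCancellation → BetaCancellation`**: line `dirichlet-companion-to-pi` assembled — the crux
of route TerasomaMultiplication follows from the `π`-cancellation item stmt-0540 alone (every other
stub of the line is a theorem of the tree). [folklore] -/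
theorem betaCancellation_of_piCancellation :
    Literature.NumberTheory.Transcendental.KZ.PiCancellation →
      Summit.KontsevichZagierPeriods.KontsevichZagierPeriods.Theses.TerasomaMultiplication.BetaCancellation :=
  fun hπ => betaCancellation_iff.2 fun _ _ ha hb => kernelCancellation_betaKernel_of_pos hπ ha hb

/-- **`BetaCancellation ↔ KZ.PiCancellation`** (unconditional): the crux stmt-13633 and the open
`π`-cancellation item stmt-0540 of route AyoubSpecialisation are EQUIVALENT inside the calculus — `→`
is the disprover's `piCancellation_of_betaCancellation` (`[β(1/2,1/2)] ∼ [π]`, `Negative/PiLink.lean`),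
`←` is `betaCancellation_of_piCancellation`. [folklore] -/
theorem betaCancellation_iff_piCancellation :
    Summit.KontsevichZagierPeriods.KontsevichZagierPeriods.Theses.TerasomaMultiplication.BetaCancellation ↔
      KZ.PiCancellation :=
  ⟨piCancellation_of_betaCancellation, betaCancellation_of_piCancellation⟩

end Summit.KontsevichZagierPeriods.KontsevichZagierPeriods.BetaCancellationLine
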